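import Summits.BirchSwinnertonDyer.BirchSwinnertonDyer.Theorems.GenusKolyvaginAtTwoGenusPrimitiveSupplyAtTwoTranspositionKummerReading
import Summits.BirchSwinnertonDyer.BirchSwinnertonDyer.Theorems.GenusKolyvaginAtTwoGenusPrimitiveSupplyAtTwoTwistMasterFrame
import Summits.BirchSwinnertonDyer.BirchSwinnertonDyer.Theorems.GenusKolyvaginAtTwoGenusPrimitiveSupplyAtTwoArchimedeanFrame
import Summits.BirchSwinnertonDyer.BirchSwinnertonDyer.Theorems.GenusKolyvaginAtTwoMazurRubinProp33
import Summits.BirchSwinnertonDyer.BirchSwinnertonDyer.Theorems.ByReductionTypeAtTwoRankOneAtTwoBigImageOddLocalOneDoorBottomTranspositionCount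
import Summits.BirchSwinnertonDyer.Rank1Residual.F1Sign2.TwoTranspositionDoorAtTwo
import HarnessLib

/-!
# Route `GenusKolyvaginAtTwo`, crux #2 `GenusPrimitiveSupplyAtTwo` (stmt-BirchSwinnertonDyer-22136):
# THE COUNTING HALF of the cell's T-2q `F1Sign2.TwoDoor.TwoTranspositionTwistLawAtTwo` — `#Sel₂(W^{(d)}) ∈ {1, 4}` with a door
# open, `∈ {4, 16}` with both doors shut — UNCONDITIONALLY (three `T`-places `{∞, q₀, q₁}`, no Poitou–Tate needed)

Width seat `bsd-line-gk2-p4` g13 (cell `bsd-f1-sign2`), sequel of `…TranspositionKummerReading` (the door at `q` is the place `q` of `Sel₂(W)`),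
gk2-p5's `…TwistMasterFrame` (ONE identification `E^{(d)}[2] ≅ E[2]` with split agreement, Lemma 2.11 at ramified good odd places, transversality
at real places, frame datum) and gk2-p4 g12's `…TwistMultiFrame` (§80 the ELEMENTARY transfer bound; part 9 Kramer's congruence for framed
identifications). THEOREMS ONLY (no definition, no named fact, no `sorry`); helper `--supports stmt-BirchSwinnertonDyer-22136`; no item is closed;
BSD is not proved by any of this.

WHAT. T-2q is Mazur–Rubin's sandwich `S_T ⊂ Sel₂(W), Sel₂(W^{(d)}) ⊂ S^T` with `T = {∞, q₀, q₁}` (`Δ_W > 0`, `d < 0` two-transposition-admissible):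
the conditions of `W` and `W^{(d)}` are TRANSVERSAL lines in the planes `H¹(ℚ_v, E[2])` at the three places and agree elsewhere. Its COUNTING half needs
no duality: `#Sel₂(W^{(d)}) ≤ 8·#S_T`, `#Sel₂(W^{(d)}) ≤ 8·#Sel₂(W) = 16` (elementary bound §80); `#Sel₂(W^{(d)})·#Sel₂(W)·8 = □` (Kramer's congruence,
framed identification) ⟹ `#Sel₂(W^{(d)}) = □`; a door open at `q_i` (⟺ `loc_{q_i} Sel₂(W) ≠ 0`, the Kummer reading) ⟹ `S_T = 0` ⟹ `∈ {1, 4}`; both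
doors shut and `E(ℚ) ⊂ E⁰(ℝ)` ⟹ `Sel₂(W) ⊂ Sel₂(W^{(d)})` ⟹ `∈ {4, 16}`. Main theorem **`twoTranspositionTwistLaw_card`** = T-2q's clauses (a).1
and (b) with T-2q's binders (the quadratic `iff` of (a), `Sel₂(W^{(d)}) = 0 ⟺ R ∩ twisted conditions = 0` — Poonen–Rains — is NOT proved here).

References: [MazurRubin2010] Def. 3.1, Lemma 3.2, Prop. 3.3 (method), Lemmas 2.9–2.11; [Kramer1981] Prop. 3, Prop. 6, Thm. 1;
[KlagsbrunMazurRubin2013] Thm. 3.9, Lemma 5.2; [SilvermanAEC2009] X.4.2 (a).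
-/

set_option linter.dupNamespace false -- tree convention: `Summit.BirchSwinnertonDyer.BirchSwinnertonDyer.Theorems` (summit = sub-problem)
set_option autoImplicit false

noncomputable section

open scoped Classical ContRepresentation

namespace Summit.BirchSwinnertonDyer.BirchSwinnertonDyer.Theorems.GenusKolyTransp

open WeierstrassCurve Field NumberField IsDedekindDomain Function
open Literature.NumberTheory.EllipticCurves Literature.NumberTheory.GaloisRepresentations
open Literature.NumberTheory.GaloisRepresentations.IsNonarchimedeanLocalField
open Literature.NumberTheory.GaloisRepresentations.DiscreteGaloisModule (SelmerStructure)
open Literature.NumberTheory.GaloisCohomology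
open Rat.HeightOneSpectrum (primesEquiv natGenerator)
open Summit.BirchSwinnertonDyer.Rank1Residual.F1Sign2
open Summit.BirchSwinnertonDyer.Rank1Residual.F1Sign2.TranspositionDoor (MeetsNonNormAt)
open Summit.BirchSwinnertonDyer.Rank1Residual.F1Sign2.TwoDoor (TwoTranspAdmissible)
open Summit.BirchSwinnertonDyer.Rank1Residual.X11b
open Summit.BirchSwinnertonDyer.Rank1Residual.X11b.CongruentTransfer
open Summit.BirchSwinnertonDyer.BirchSwinnertonDyer.Theorems.GenusKolyTwistLocal
open Summit.BirchSwinnertonDyer.BirchSwinnertonDyer.Theorems.GenusKolyArch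
open Summit.BirchSwinnertonDyer.BirchSwinnertonDyer.Theorems.GenusKolyTwistTamagawa
  (transport_twist_agree_inr_of_menu)
open Summit.BirchSwinnertonDyer.BirchSwinnertonDyer.Theorems.GenusKolyTwistingPrime (primesEquiv_eq natCast_not_mem_of_not_dvd)
open Summit.BirchSwinnertonDyer.BirchSwinnertonDyer.Theorems.GenusKolyTwistRamified
  (valuation_natCast_eq_exp_neg_one_of_mem closureEmb_geomSqrt_not_mem_maxUnramified_rat)
open Summit.BirchSwinnertonDyer.BirchSwinnertonDyer.Theorems.RankOneAtTwoOneDoor (natCard_ker_nsmul_adicCompletion_two_eq_two_of_jacobiSym)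
open Summit.BirchSwinnertonDyer.Rank1Residual.GaloisImage.CoreRankZero (selmerGroup_mono)

universe u

variable (W : WeierstrassCurve ℚ) [W.IsElliptic] [W.IsGloballyMinimal]

/-! ## §9 The `T`-place facts at a transposition prime of `d` -/

/-- **The `T`-place facts at a transposition prime** `q ∣ d` (`d` squarefree, `≡ 1 (8)`, `q` good with `(Δ/q) = −1`, `v ∋ q`): `q` odd, `q ∤ Δ_min`,
good reduction at `v`, `ℚ(√d)` ramified at `v` (`v(d) = 1`), `#E(ℚ_v)[2] = 2`. [cite: MazurRubin2010, Lemma 2.2 (i) and Lemma 2.11] [cite: Kramer1981, Prop. 3] -/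
theorem transposition_place_facts {d : ℤ} (hsf : Squarefree d) (hd8 : d % 8 = 1) {q : ℕ} [Fact q.Prime] (hqd : (q : ℤ) ∣ d)
    (hgood : W.HasGoodReductionAtPrime q) (hjac : jacobiSym W.Δ.num q = -1) {v : HeightOneSpectrum (𝓞 ℚ)}
    (hv : (q : 𝓞 ℚ) ∈ v.asIdeal) :
    q ≠ 2 ∧ ¬ (q : ℤ) ∣ minimalDiscriminantInt W ∧ ((2 : ℕ) : 𝓞 ℚ) ∉ v.asIdeal ∧ W.HasGoodReductionAt v ∧
      closureEmb (K := ℚ) (v.adicCompletion ℚ) (geomSqrt ((d : ℤ) : ℚ)) ∉ maxUnramified (v.adicCompletion ℚ) ∧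
      Nat.card (nsmulAddMonoidHom 2 : (W.baseChange (v.adicCompletion ℚ)).toAffine.Point →+ _).ker = 2 := by
  have hq : q.Prime := Fact.out
  have hq2 : q ≠ 2 := by
    rintro rfl
    have h2d : (2 : ℤ) ∣ d := by exact_mod_cast hqd
    omega
  have hn2 : ¬ q ∣ 2 := fun h ↦ hq2 ((Nat.prime_dvd_prime_iff_eq hq Nat.prime_two).mp h)
  have hqΔ : ¬ (q : ℤ) ∣ minimalDiscriminantInt W := W.not_dvd_minimalDiscriminantInt_of_hasGoodReductionAtPrime' _ hgood
  have hqΔ' : ¬ (q : ℤ) ∣ W.Δ.num := by rwa [← cast_minimalDiscriminantInt W, Rat.num_intCast]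
  have hvW : W.HasGoodReductionAt v := by
    obtain hpq := primesEquiv_eq hq hv
    subst hpq
    exact (hasGoodReductionAtPrime_iff_hasGoodReductionAt_ringOfIntegers v W).mp hgood
  refine ⟨hq2, hqΔ, natCast_not_mem_of_not_dvd hq hv hn2, hvW, ?_,
    natCard_ker_nsmul_adicCompletion_two_eq_two_of_jacobiSym W hq2 hgood hqΔ' hjac hv⟩
  apply closureEmb_geomSqrt_not_mem_maxUnramified_rat v
  obtain ⟨m, hm⟩ := hqd
  have hqm : ¬ (q : ℤ) ∣ m := fun hm' ↦ by
    have hsq : (q : ℤ) * q ∣ d := by rw [hm]; exact mul_dvd_mul_left _ hm'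
    have hu := hsf _ hsq
    rw [Int.isUnit_iff] at hu
    rcases hu with hu | hu
    · exact hq.one_lt.ne' (by exact_mod_cast hu)
    · have : (0 : ℤ) ≤ (q : ℤ) := by positivity
      omega
  rw [show ((d : ℤ) : ℚ) = ((q : ℕ) : ℚ) * ((m : ℤ) : ℚ) by rw [hm]; push_cast; ring, Valuation.map_mul,
    valuation_natCast_eq_exp_neg_one_of_mem v hq hv, valuation_intCast_eq_one_of_not_dvd (K := ℚ) (v := v) hq hv hqm, mul_one]

/-! ## §10 A two-transposition-admissible `(d, q₀, q₁)` puts every finite place `v ∉ {v_{q₀}, v_{q₁}}` on the menu -/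

/-- **The finite place menu off the two door primes** (`F1Sign2.TwoDoor.TwoTranspAdmissible W d q₀ q₁`; `v_i ∋ q_i`): every finite
place `v ≠ v₀, v₁` of `ℚ` is split in `ℚ(√d)` (over `2` and the odd bad primes), or odd and silent for both curves (the primes `q ≠ q₀, q₁` of
`d`: `a_q` odd), or odd and good for both. [cite: Serre1973, Ch. II §3.3 Thm 3] [cite: Serre1973, Ch. II §3.3 Thm 4] [cite: Kramer1981, Prop. 3]
[cite: MazurRubin2010, Lemma 2.10] -/
theorem twoTranspAdmissible_place_menu {d : ℤ} {q₀ q₁ : ℕ} (hd : TwoTranspAdmissible W d q₀ q₁)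
    {v₀ v₁ : HeightOneSpectrum (𝓞 ℚ)} (hv₀ : (q₀ : 𝓞 ℚ) ∈ v₀.asIdeal) (hv₁ : (q₁ : 𝓞 ℚ) ∈ v₁.asIdeal)
    {Wd : WeierstrassCurve ℚ} [Wd.IsElliptic] {C : VariableChange ℚ} (hC : C • W.quadraticTwist (d : ℚ) = Wd)
    (φ : (Wd.torsionGaloisModule ((2 : ℕ) : ℤ)).toContRepresentation →ⁱL
      (W.torsionGaloisModule ((2 : ℕ) : ℤ)).toContRepresentation)
    (ψ : (W.torsionGaloisModule ((2 : ℕ) : ℤ)).toContRepresentation →ⁱL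
      (Wd.torsionGaloisModule ((2 : ℕ) : ℤ)).toContRepresentation)
    (hψφ : ∀ a, ψ (φ a) = a) (hφψ : ∀ b, φ (ψ b) = b) :
    ∀ v : HeightOneSpectrum (𝓞 ℚ), v ≠ v₀ → v ≠ v₁ →
      (∃ s : v.adicCompletion ℚ, s ^ 2 = algebraMap ℚ (v.adicCompletion ℚ) (d : ℚ)) ∨
      (((2 : ℕ) : 𝓞 ℚ) ∉ v.asIdeal ∧
        ¬ 2 ∣ (W.baseChange (v.adicCompletion ℚ)).localTamagawaNumber (v.adicCompletionIntegers ℚ) ∧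
        ¬ 2 ∣ (Wd.baseChange (v.adicCompletion ℚ)).localTamagawaNumber (v.adicCompletionIntegers ℚ)) ∨
      (((2 : ℕ) : 𝓞 ℚ) ∉ v.asIdeal ∧ W.HasGoodReductionAt v ∧ Wd.HasGoodReductionAt v) ∨
      (((2 : ℕ) : 𝓞 ℚ) ∉ v.asIdeal ∧
        Nat.card (nsmulAddMonoidHom 2 : (W.baseChange (v.adicCompletion ℚ)).toAffine.Point →+ _).ker = 1 ∧
        Nat.card (nsmulAddMonoidHom 2 : (Wd.baseChange (v.adicCompletion ℚ)).toAffine.Point →+ _).ker = 1) := by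
  obtain ⟨-, -, hd8, hq₀, hq₁, -, -, -, -, -, hprimes, hbad⟩ := hd
  intro v hv hv'
  haveI := Fact.mk (primesEquiv v).2
  have hpP : (primesEquiv v : ℕ).Prime := (primesEquiv v).2
  have hpv : ((primesEquiv v : ℕ) : 𝓞 ℚ) ∈ v.asIdeal := Rat.HeightOneSpectrum.natCast_natGenerator_mem v
  have hsplit : IsSquare ((d : ℤ) : ℚ_[(primesEquiv v : ℕ)]) →
      ∃ s : v.adicCompletion ℚ, s ^ 2 = algebraMap ℚ (v.adicCompletion ℚ) (d : ℚ) := fun hsq ↦ by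
    have hsq' : IsSquare (((d : ℚ) : ℚ) : ℚ_[(primesEquiv v : ℕ)]) := by
      simpa only [Rat.cast_intCast] using hsq
    obtain ⟨s, hs⟩ := TwoDescentLocal.isSquare_algebraMap_adicCompletion_of_padic v hsq'
    exact ⟨s, by rw [sq]; exact hs.symm⟩
  by_cases hp2 : (primesEquiv v : ℕ) = 2
  · exact Or.inl (hsplit (Literature.NumberTheory.QuadraticForms.padic_isSquare_intCast_of_mod_eight hp2 hd8))
  have h2v : ((2 : ℕ) : 𝓞 ℚ) ∉ v.asIdeal :=
    GenusKolyTwistingPrime.natCast_not_mem_of_not_dvd hpP hpv fun h ↦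
      hp2 ((Nat.prime_dvd_prime_iff_eq hpP Nat.prime_two).mp h)
  by_cases hpd : ((primesEquiv v : ℕ) : ℤ) ∣ d
  · obtain ⟨hgood, hodd⟩ := hprimes _ hpP hpd
    have hpq₀ : (primesEquiv v : ℕ) ≠ q₀ := fun h ↦
      hv (primesEquiv.injective (Subtype.ext (h.trans (primesEquiv_eq hq₀ hv₀).symm)))
    have hpq₁ : (primesEquiv v : ℕ) ≠ q₁ := fun h ↦
      hv' (primesEquiv.injective (Subtype.ext (h.trans (primesEquiv_eq hq₁ hv₁).symm)))
    have hodd' := hodd hpq₀ hpq₁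
    have hgood' : W.HasGoodReductionAtPrime (primesEquiv v : ℕ) := hgood inferInstance
    have hpΔ : ¬ ((primesEquiv v : ℕ) : ℤ) ∣ minimalDiscriminantInt W :=
      W.not_dvd_minimalDiscriminantInt_of_hasGoodReductionAtPrime' _ hgood'
    have hsil := (GenusKolyTwin.silent_iff_odd_frobeniusTrace W hp2 hpΔ).mpr hodd'
    have hker : Nat.card (nsmulAddMonoidHom 2 : (W.baseChange (v.adicCompletion ℚ)).toAffine.Point →+ _).ker = 1 := by
      rw [natCard_ker_nsmul_adicCompletion_eq_padic W v 2]
      have h0 := GenusKolyTwin.twoTorsion_padic_eq_zero_of_forall_ne W hp2 hpΔ hsil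
      rw [Nat.card_eq_one_iff_unique]
      refine ⟨⟨fun a b ↦ Subtype.ext ((h0 a.1 a.2).trans (h0 b.1 b.2).symm)⟩, ⟨⟨0, by simp⟩⟩⟩
    refine Or.inr (Or.inr (Or.inr ⟨h2v, hker, ?_⟩))
    rw [@natCard_ker_nsmul_eq_of_intertwining ℚ _ _ W Wd _ _ 2 two_ne_zero φ ψ hψφ hφψ (v.adicCompletion ℚ) _
      (HeightOneSpectrum.instAlgebraAdicCompletion (𝓞 ℚ) ℚ v) (charZero_adicCompletion v)]
    exact hker
  by_cases hpN : (primesEquiv v : ℕ) ∣ W.conductorNorm ℤ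
  · have hnotgood : ∀ _h : Fact (primesEquiv v : ℕ).Prime, ¬ W.HasGoodReductionAtPrime (primesEquiv v : ℕ) := fun _ hg ↦
      not_dvd_conductorNorm_of_hasGoodReductionAtPrime W hg hpN
    have hJ := hbad _ hpP hp2 hnotgood
    exact Or.inl (hsplit (padic_isSquare_of_jacobiSym_eq_one hp2 hJ))
  · have hW : W.HasGoodReductionAt v := by
      by_contra h
      exact hpN ((W.dvd_conductorNorm_iff v).mpr h)
    have hp2d : ¬ (((primesEquiv v : Nat.Primes) : ℕ) : ℤ) ∣ 2 * d := by
      intro h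
      rcases (Nat.prime_iff_prime_int.mp hpP).dvd_or_dvd h with h2' | hd'
      · exact hp2 ((Nat.prime_dvd_prime_iff_eq hpP Nat.prime_two).mp (by exact_mod_cast h2'))
      · exact hpd hd'
    exact Or.inr (Or.inr (Or.inl ⟨h2v, hW, hasGoodReductionAt_of_smul_quadraticTwist W v hp2d hW hC⟩))

/-! ## §11 Squares among small powers of two -/

omit W
/-- An even power of two at most `8` is `1` or `4`. [folklore] -/
private theorem two_pow_eq_one_or_four {b : ℕ} (hb : Even b) (h8 : 2 ^ b ≤ 8) : 2 ^ b = 1 ∨ 2 ^ b = 4 := by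
  obtain ⟨k, rfl⟩ := hb
  have hk : k ≤ 1 := by
    by_contra h
    have h4 : 2 ^ (2 + 2) ≤ 2 ^ (k + k) := Nat.pow_le_pow_right (by norm_num) (by omega)
    omega
  interval_cases k <;> simp

/-- An even power of two between `2` and `16` is `4` or `16`. [folklore] -/
private theorem two_pow_eq_four_or_sixteen {b : ℕ} (hb : Even b) (h2 : 2 ≤ 2 ^ b) (h16 : 2 ^ b ≤ 16) :
    2 ^ b = 4 ∨ 2 ^ b = 16 := by
  obtain ⟨k, rfl⟩ := hb
  have hk : k ≤ 2 := by
    by_contra h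
    have h4 : 2 ^ (3 + 3) ≤ 2 ^ (k + k) := Nat.pow_le_pow_right (by norm_num) (by omega)
    omega
  interval_cases k <;> simp_all

/-! ## §12 The counting half of T-2q -/
/-- **THE COUNTING HALF OF T-2q `F1Sign2.TwoDoor.TwoTranspositionTwistLawAtTwo`, UNCONDITIONAL.** For every globally minimal elliptic `W/ℚ` with
`Δ_W > 0`, `E(ℚ)[2] = 0`, rank `1`, `Ш(W)[2] = 0`, `E(ℚ) ⊂ E⁰(ℝ)` and every two-transposition-admissible `(d, q₀, q₁)`: (a).1 a door open at `q₀` or `q₁`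
⟹ `#Sel₂(W^{(d)}) ∈ {1, 4}`; (b) both shut ⟹ `#Sel₂(W^{(d)}) ∈ {4, 16}` (sandwich at `T = {∞, v_{q₀}, v_{q₁}}` for ONE framed identification: elementary
bounds, Kramer's congruence, the Kummer reading of the doors). The quadratic `iff` clause of T-2q (a) is not addressed.
[cite: MazurRubin2010, Def. 3.1, Lemma 3.2, Lemmas 2.9–2.11] [cite: Kramer1981, Prop. 3, Prop. 6, Thm. 1] [cite: KlagsbrunMazurRubin2013, Thm. 3.9] -/
theorem twoTranspositionTwistLaw_card :
    ∀ (W : WeierstrassCurve ℚ) [W.IsElliptic] [W.IsGloballyMinimal], 0 < W.Δ → NoRationalTwoTorsion W →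
      W.mordellWeilRank = 1 → ShaTwoTrivial W → ¬ MeetsEgg W →
      ∀ (d : ℤ) (q₀ q₁ : ℕ) [Fact q₀.Prime] [Fact q₁.Prime], TwoTranspAdmissible W d q₀ q₁ →
        ((MeetsNonNormAt W q₀ ∨ MeetsNonNormAt W q₁) → twistSelmerTwoCard W d = 1 ∨ twistSelmerTwoCard W d = 4) ∧
        (¬ MeetsNonNormAt W q₀ → ¬ MeetsNonNormAt W q₁ → twistSelmerTwoCard W d = 4 ∨ twistSelmerTwoCard W d = 16) := by
  intro W _ _ hΔ hT hrank hSha hegg d q₀ q₁ _ _ hadm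
  haveI : Fact (Nat.Prime 2) := ⟨Nat.prime_two⟩
  have hd := hadm
  obtain ⟨hdneg, hsf, hd8, hq₀, hq₁, hne, hq₀d, hq₁d, hjac₀, hjac₁, hprimes, -⟩ := hadm
  -- the places of the two door primes and the `T`-place facts there
  have hplace : ∀ {q : ℕ} (hq : q.Prime), ∃ v : HeightOneSpectrum (𝓞 ℚ), (q : 𝓞 ℚ) ∈ v.asIdeal := fun {q} hq ↦
    ⟨primesEquiv.symm ⟨q, hq⟩, by
      have h := Rat.HeightOneSpectrum.natCast_natGenerator_mem (primesEquiv.symm ⟨q, hq⟩)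
      rwa [show natGenerator (primesEquiv.symm ⟨q, hq⟩) = q from
        congrArg Subtype.val (primesEquiv.apply_symm_apply (⟨q, hq⟩ : Nat.Primes))] at h⟩
  obtain ⟨v₀, hv₀⟩ := hplace hq₀
  obtain ⟨v₁, hv₁⟩ := hplace hq₁
  have hv₀₁ : v₀ ≠ v₁ := by
    intro h
    apply hne
    rw [← primesEquiv_eq hq₀ hv₀, ← primesEquiv_eq hq₁ hv₁, h]
  obtain ⟨hq₀2, hq₀Δ, h2v₀, hv₀W, hram₀, ht₀⟩ :=
    transposition_place_facts W hsf hd8 hq₀d ((hprimes q₀ hq₀ hq₀d).1 inferInstance) hjac₀ hv₀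
  obtain ⟨hq₁2, hq₁Δ, h2v₁, hv₁W, hram₁, ht₁⟩ :=
    transposition_place_facts W hsf hd8 hq₁d ((hprimes q₁ hq₁ hq₁d).1 inferInstance) hjac₁ hv₁
  -- the twist and ONE framed identification with all local properties
  have hd0 : d ≠ 0 := hdneg.ne
  have hdQ : ((d : ℤ) : ℚ) ≠ 0 := by exact_mod_cast hd0
  haveI := W.isElliptic_quadraticTwist hdQ
  set Wd : WeierstrassCurve ℚ := W.quadraticTwist ((d : ℤ) : ℚ) with hWd
  have hC : (1 : VariableChange ℚ) • W.quadraticTwist ((d : ℤ) : ℚ) = Wd := one_smul _ _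
  obtain ⟨φ, ψ, hψφ, hφψ, hsplit, -, htrfin, htrinf, π, A, hπ, hA⟩ := exists_intertwining_master_frame W Wd hdQ hC
  let 𝓚 : SelmerStructure (W.torsionGaloisModule ((2 : ℕ) : ℤ)) := W.kummerSelmerStructure ((2 : ℕ) : ℤ)
  have h𝓚 : ∀ v, 𝓚 v = W.kummerSelmerStructure ((2 : ℕ) : ℤ) v := fun _ ↦ rfl
  let 𝓐 : SelmerStructure (W.torsionGaloisModule ((2 : ℕ) : ℤ)) := fun v ↦
    (Wd.kummerSelmerStructure ((2 : ℕ) : ℤ) v).map (galoisCohomology.map (φ.restrictField (Place.Completion v)) 1)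
  have h𝓐 : ∀ v, 𝓐 v = (Wd.kummerSelmerStructure ((2 : ℕ) : ℤ) v).map
      (galoisCohomology.map (φ.restrictField (Place.Completion v)) 1) := fun _ ↦ rfl
  -- the three `T`-places
  set w₀ : InfinitePlace ℚ := Rat.infinitePlace with hw₀def
  have hw₀ : w₀.IsReal := Rat.isReal_infinitePlace
  have hΔ' : 0 < InfinitePlace.embedding_of_isReal hw₀ W.Δ := by rwa [embedding_of_isReal_rat_apply, Rat.cast_pos]
  have hΔd : 0 < Wd.Δ := by
    rw [hWd, quadraticTwist_Δ]
    exact mul_pos (by positivity) hΔ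
  have hΔd' : 0 < InfinitePlace.embedding_of_isReal hw₀ Wd.Δ := by rwa [embedding_of_isReal_rat_apply, Rat.cast_pos]
  let S : Finset (Place ℚ) := {Sum.inl w₀, Sum.inr v₀, Sum.inr v₁}
  have hS₀ : (Sum.inl w₀ : Place ℚ) ∉ ({Sum.inr v₀, Sum.inr v₁} : Finset (Place ℚ)) := by simp
  have hS₁ : (Sum.inr v₀ : Place ℚ) ∉ ({Sum.inr v₁} : Finset (Place ℚ)) := by simpa using hv₀₁
  have hmemS : ∀ v : Place ℚ, v ∈ S ↔ v = Sum.inl w₀ ∨ v = Sum.inr v₀ ∨ v = Sum.inr v₁ := fun v ↦ by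
    simp only [S, Finset.mem_insert, Finset.mem_singleton]
  -- agreement off `S` from the menu
  have hagree : ∀ v ∉ S, 𝓐 v = 𝓚 v := by
    rintro (w | v) hv
    · exact absurd ((hmemS _).mpr (Or.inl (by rw [Subsingleton.elim w w₀]))) hv
    · have hv0 : v ≠ v₀ := fun h ↦ hv ((hmemS _).mpr (Or.inr (Or.inl (by rw [h]))))
      have hv1 : v ≠ v₁ := fun h ↦ hv ((hmemS _).mpr (Or.inr (Or.inr (by rw [h]))))
      exact transport_twist_agree_inr_of_menu W φ ψ hφψ hsplit 𝓐 h𝓐 v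
        (twoTranspAdmissible_place_menu W hd hv₀ hv₁ hC φ ψ hψφ hφψ v hv0 hv1)
  -- local counts: `#𝓚_v = #𝓐_v = 2` and transversality at the three places
  have hKinl : Nat.card (𝓚 (Sum.inl w₀)) = 2 := natCard_kummerSelmerStructure_inl_eq_two_of_isReal W hw₀ hΔ'
  have hKinr : ∀ {v : HeightOneSpectrum (𝓞 ℚ)}, ((2 : ℕ) : 𝓞 ℚ) ∉ v.asIdeal →
      Nat.card (nsmulAddMonoidHom 2 : (W.baseChange (v.adicCompletion ℚ)).toAffine.Point →+ _).ker = 2 →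
      Nat.card (𝓚 (Sum.inr v)) = 2 := fun {v} h2v ht ↦ by
    rw [h𝓚, W.natCard_kummerSelmerStructure_inr v two_ne_zero, natCard_quotient_span_natCast_eq_one_of_not_mem v h2v, mul_one]
    exact ht
  have hAcard : ∀ v : Place ℚ, Nat.card (𝓐 v) = Nat.card (Wd.kummerSelmerStructure ((2 : ℕ) : ℤ) v) := fun v ↦ by
    rw [h𝓐]
    exact Nat.card_congr (AddSubgroup.equivMapOfInjective _ _ (map_restrictField_injective_of_comp_eq φ ψ hψφ v)).toEquiv.symm
  have hAinl : Nat.card (𝓐 (Sum.inl w₀)) = 2 := by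
    rw [hAcard]
    exact natCard_kummerSelmerStructure_inl_eq_two_of_isReal Wd hw₀ hΔd'
  have hAinr : ∀ {v : HeightOneSpectrum (𝓞 ℚ)}, ((2 : ℕ) : 𝓞 ℚ) ∉ v.asIdeal →
      Nat.card (nsmulAddMonoidHom 2 : (W.baseChange (v.adicCompletion ℚ)).toAffine.Point →+ _).ker = 2 →
      Nat.card (𝓐 (Sum.inr v)) = 2 := fun {v} h2v ht ↦ by
    rw [hAcard, Wd.natCard_kummerSelmerStructure_inr v two_ne_zero, natCard_quotient_span_natCast_eq_one_of_not_mem v h2v, mul_one,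
      @natCard_ker_nsmul_eq_of_intertwining ℚ _ _ W Wd _ _ 2 two_ne_zero φ ψ hψφ hφψ (v.adicCompletion ℚ) _
        (HeightOneSpectrum.instAlgebraAdicCompletion (𝓞 ℚ) ℚ v) (charZero_adicCompletion v)]
    exact ht
  have htrinl : 𝓐 (Sum.inl w₀) ⊓ 𝓚 (Sum.inl w₀) = ⊥ := by
    rw [h𝓐, h𝓚, kummerSelmerStructure_apply, kummerSelmerStructure_apply]
    exact htrinf w₀ hw₀ hΔ' (forall_sq_ne_completion_of_neg (by exact_mod_cast hdneg) w₀)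
  have htrinr : ∀ {v : HeightOneSpectrum (𝓞 ℚ)}, W.HasGoodReductionAt v → ((2 : ℕ) : 𝓞 ℚ) ∉ v.asIdeal →
      closureEmb (K := ℚ) (v.adicCompletion ℚ) (geomSqrt ((d : ℤ) : ℚ)) ∉ maxUnramified (v.adicCompletion ℚ) →
      𝓐 (Sum.inr v) ⊓ 𝓚 (Sum.inr v) = ⊥ := fun {v} hvW h2v hram ↦ by
    rw [h𝓐, h𝓚, kummerSelmerStructure_apply, kummerSelmerStructure_apply]
    exact htrfin v hvW h2v hram
  have hrel : ∀ v : Place ℚ, 𝓐 v ⊓ 𝓚 v = ⊥ → Nat.card (𝓚 v) = 2 → (𝓐 v).relIndex (𝓚 v) = 2 := fun v htr hK ↦ by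
    rw [← AddSubgroup.inf_relIndex_right, htr, AddSubgroup.relIndex_bot_left]
    exact hK
  -- the products over `S`
  have hprodA : ∏ v ∈ S, Nat.card (𝓐 v) = 8 := by
    rw [Finset.prod_insert hS₀, Finset.prod_insert hS₁, Finset.prod_singleton, hAinl, hAinr h2v₀ ht₀, hAinr h2v₁ ht₁]
    norm_num
  have hprodK : ∏ v ∈ S, Nat.card (𝓚 v) = 8 := by
    rw [Finset.prod_insert hS₀, Finset.prod_insert hS₁, Finset.prod_singleton, hKinl, hKinr h2v₀ ht₀, hKinr h2v₁ ht₁]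
    norm_num
  have hprodrel : ∏ v ∈ S, (𝓐 v).relIndex (𝓚 v) = 8 := by
    rw [Finset.prod_insert hS₀, Finset.prod_insert hS₁, Finset.prod_singleton,
      hrel _ htrinl hKinl, hrel _ (htrinr hv₀W h2v₀ hram₀) (hKinr h2v₀ ht₀), hrel _ (htrinr hv₁W h2v₁ hram₁) (hKinr h2v₁ ht₁)]
    norm_num
  -- Selmer cardinalities
  have hSelA : Nat.card 𝓐.selmerGroup = Nat.card (Wd.selmerGroup ((2 : ℕ) : ℤ)) :=
    natCard_selmerGroup_transport_kummer W Wd 2 φ ψ hψφ hφψ 𝓐 h𝓐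
  have hSelW : Nat.card (W.selmerGroup ((2 : ℕ) : ℤ)) = 2 := by
    rw [Nat.cast_ofNat]
    exact selmerTwoCard_eq_two_of_rank_one W hT hrank hSha
  have hSelK' : Nat.card 𝓚.selmerGroup = Nat.card (W.selmerGroup ((2 : ℕ) : ℤ)) := by
    rw [selmerGroup_eq_selmerGroup_kummerSelmerStructure]
    rfl
  have hSelK : Nat.card 𝓚.selmerGroup = 2 := hSelK'.trans hSelW
  have hmodel : Nat.card (Wd.selmerGroup ((2 : ℕ) : ℤ)) = twistSelmerTwoCard W d := by
    rw [Nat.cast_ofNat]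
    exact GenusKolyTwin.natCard_selmerGroup_model_eq_twistSelmerTwoCard W hd0 Wd ⟨1, hC⟩
  obtain ⟨b, hb⟩ := Literature.NumberTheory.EllipticCurves.exists_natCard_selmerGroup_eq_pow Wd 2
  have hbWd : twistSelmerTwoCard W d = 2 ^ b := by rw [← hmodel, Nat.cast_ofNat]; exact hb
  haveI hfinK : Finite 𝓚.selmerGroup := Nat.finite_of_card_ne_zero (by rw [hSelK]; norm_num)
  haveI hfinWd : Finite (Wd.selmerGroup ((2 : ℕ) : ℤ)) := Wd.finite_selmerGroup_holds (by norm_num)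
  haveI hfinA : Finite 𝓐.selmerGroup :=
    Nat.finite_of_card_ne_zero (by rw [hSelA]; exact (Nat.card_pos (α := Wd.selmerGroup ((2 : ℕ) : ℤ))).ne')
  -- Kramer's congruence for the framed identification at `S`: `#Sel(Wd)` is a square
  have heven : Even b := by
    have h := GenusKolyKramer.isSquare_card_selmerGroup_mul_of_frame W Wd φ (Function.LeftInverse.injective hψφ) π hπ A hA
      𝓐 h𝓐 S hagree
    rw [hprodrel, hSelW, hmodel, hbWd, show 2 ^ b * 2 * 8 = 2 ^ (b + 4) by ring, isSquare_two_pow_iff_even] at h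
    exact (Nat.even_add.mp h).mpr (by decide)
  -- the upper bound `#Sel(Wd) ≤ 16`
  have h16 : 2 ^ b ≤ 16 := by
    have h := natCard_selmerGroup_le_mul_prod_of_agree_off W 2 𝓐 𝓚 S hagree
    rw [hSelA, hSelK, hprodA, hmodel, hbWd] at h
    omega
  rw [hbWd]
  refine ⟨fun hdoor ↦ ?_, fun hshut₀ hshut₁ ↦ ?_⟩
  · -- (a).1: a door is open ⟹ `S_T = 0` ⟹ `#Sel(Wd) ≤ 8`
    obtain ⟨c₀, hc₀, hne₀⟩ : ∃ c ∈ 𝓚.selmerGroup, galoisCohomology.localization (W.torsionGaloisModule ((2 : ℕ) : ℤ)) (Sum.inr v₀) 1 c ≠ 0 ∨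
        galoisCohomology.localization (W.torsionGaloisModule ((2 : ℕ) : ℤ)) (Sum.inr v₁) 1 c ≠ 0 := by
      rcases hdoor with h | h
      · obtain ⟨c, hc, hne⟩ := exists_mem_selmerGroup_localization_ne_zero_of_meetsNonNormAt W v₀ hv₀ hq₀2 hq₀Δ h
        exact ⟨c, hc, Or.inl hne⟩
      · obtain ⟨c, hc, hne⟩ := exists_mem_selmerGroup_localization_ne_zero_of_meetsNonNormAt W v₁ hv₁ hq₁2 hq₁Δ h
        exact ⟨c, hc, Or.inr hne⟩
    -- the strict structure at `S`
    let 𝓢 : SelmerStructure (W.torsionGaloisModule ((2 : ℕ) : ℤ)) := fun v ↦ if v ∈ S then ⊥ else 𝓚 v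
    have h𝓢S : ∀ v ∈ S, 𝓢 v = ⊥ := fun v hv ↦ if_pos hv
    have hagreeS : ∀ v ∉ S, 𝓐 v = 𝓢 v := fun v hv ↦ by rw [hagree v hv]; exact (if_neg hv).symm
    have hle : 𝓢 ≤ 𝓚 := fun v ↦ by
      by_cases hv : v ∈ S
      · rw [h𝓢S v hv]; exact bot_le
      · exact (if_neg hv).le
    have hleSel : 𝓢.selmerGroup ≤ 𝓚.selmerGroup := selmerGroup_mono hle
    haveI : Finite 𝓢.selmerGroup := Finite.of_injective _ (AddSubgroup.inclusion_injective hleSel)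
    have hc₀S : c₀ ∉ 𝓢.selmerGroup := by
      intro hcS
      have h0 : ∀ v ∈ S, galoisCohomology.localization (W.torsionGaloisModule ((2 : ℕ) : ℤ)) v 1 c₀ = 0 := fun v hv ↦ by
        have h := (𝓢.mem_selmerGroup_iff c₀).mp hcS v
        rwa [h𝓢S v hv, AddSubgroup.mem_bot] at h
      rcases hne₀ with hne | hne
      · exact hne (h0 _ ((hmemS _).mpr (Or.inr (Or.inl rfl))))
      · exact hne (h0 _ ((hmemS _).mpr (Or.inr (Or.inr rfl))))
    have hScard : Nat.card 𝓢.selmerGroup = 1 := by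
      have hdvd : Nat.card 𝓢.selmerGroup ∣ Nat.card 𝓚.selmerGroup := AddSubgroup.card_dvd_of_le hleSel
      rw [hSelK] at hdvd
      rcases (Nat.dvd_prime Nat.prime_two).mp hdvd with h | h
      · exact h
      · exfalso
        have heq : 𝓢.selmerGroup = 𝓚.selmerGroup := AddSubgroup.eq_of_le_of_card_ge hleSel (by rw [h, hSelK])
        exact hc₀S (heq ▸ hc₀)
    have h8 : 2 ^ b ≤ 8 := by
      have h := natCard_selmerGroup_le_mul_prod_of_agree_off W 2 𝓐 𝓢 S hagreeS
      rw [hSelA, hScard, hprodA, hmodel, hbWd] at h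
      omega
    exact two_pow_eq_one_or_four heven h8
  · -- (b): both doors shut and `E(ℚ) ⊂ E⁰(ℝ)` ⟹ `Sel(W) ⊂ Sel(Wd)` ⟹ `2 ≤ #Sel(Wd)`
    have hstrict₀ := forall_mem_selmerGroup_localization_eq_zero_of_not_meetsNonNormAt W v₀ hv₀ hq₀2 hq₀Δ hSha hshut₀
    have hstrict₁ := forall_mem_selmerGroup_localization_eq_zero_of_not_meetsNonNormAt W v₁ hv₁ hq₁2 hq₁Δ hSha hshut₁
    have hstrictinf := forall_mem_selmerGroup_localization_inl_eq_zero_of_not_meetsEgg W hΔ hT hSha hegg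
    have hKA : 𝓚.selmerGroup ≤ 𝓐.selmerGroup := by
      intro c hc
      refine (𝓐.mem_selmerGroup_iff c).mpr fun v ↦ ?_
      by_cases hv : v ∈ S
      · rcases (hmemS v).mp hv with rfl | rfl | rfl
        · rw [hstrictinf c hc]; exact zero_mem _
        · rw [hstrict₀ c hc]; exact zero_mem _
        · rw [hstrict₁ c hc]; exact zero_mem _
      · rw [hagree v hv]
        exact (𝓚.mem_selmerGroup_iff c).mp hc v
    have h2 : 2 ≤ 2 ^ b := by
      have h := AddSubgroup.card_le_of_le hKA
      rw [hSelK, hSelA, hmodel, hbWd] at h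
      exact h
    exact two_pow_eq_four_or_sixteen heven h2 h16

end Summit.BirchSwinnertonDyer.BirchSwinnertonDyer.Theorems.GenusKolyTransp

end
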